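import Literature.NumberTheory.Transcendental.CuspValueAlgebraicCoeff
import Mathlib.Analysis.Analytic.IsolatedZeros
import Mathlib.Analysis.Calculus.FDeriv.Analytic
import Mathlib.Analysis.Calculus.IteratedDeriv.Lemmas
import Mathlib.Algebra.MvPolynomial.Funext
import Mathlib.Algebra.MvPolynomial.Degrees
import Mathlib.Analysis.Complex.Polynomial.Basic
import HarnessLib

/-!
# Taylor coefficients of an analytic solution of an algebraic relation are algebraic

Let `Φ` be analytic at `0`, let `e ≥ 1`, `N ≥ 0`, and let `R ∈ ℂ[X, Y]` be a nonzero polynomial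
with ALGEBRAIC coefficients such that `R(t⁻ᵉ, Φ(t)/tᴺ) = 0` on a punctured neighbourhood of
`t = 0`. Then every Taylor coefficient `Φ⁽ⁿ⁾(0)` of `Φ` at `0` is algebraic over `ℚ`
(`isAlgebraic_iteratedDeriv_of_mvPolynomial_relation`). This is the arithmetic normal form of a
cusp of a `ℚ`-curve (crux `RigidCore.SparsityTwo`, line cusp-germ-schneider-sparsity), proved by
induction on the Taylor coefficients instead of formal Puiseux theory:

* clearing denominators gives a genuine bivariate polynomial `P(t, Y)` over the field `L` of
  complex algebraic numbers, nonzero, with `P(t, Φ t) = 0` for small `t ≠ 0`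
  (`exists_bivariate_relation_of_mvPolynomial_relation`); we work in `K[Y][t]` for a field `K`
  with an embedding `ι : K →+* ℂ` (outer variable `t`), evaluated in `ℂ` through `ι`;
* writing `P = tᵃ · P₁` with `P₁(0, ·) ≠ 0`, continuity gives `P₁(0, Φ 0) = 0`, so `Φ 0` is
  algebraic (`exists_reduced_bivariate_relation`);
* `Φ t = Φ 0 + t · Ψ t` with `Ψ = dslope Φ 0` analytic
  (`HasFPowerSeriesAt.has_fpower_series_dslope_fslope`, coefficients shifted by one), and
  `P₂(t, Y) := P₁(t, Φ 0 + tY)` is again nonzero over `L` with `P₂(t, Ψ t) = 0`; induction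
  (`isAlgebraic_coeff_of_bivariate_relation`).

[folklore]
-/

noncomputable section

open Filter Polynomial
open _root_.Topology

namespace Literature.NumberTheory.Transcendental

/-- A complex number algebraic over the field of complex algebraic numbers is algebraic over `ℚ`.
[folklore] -/
theorem isAlgebraic_rat_of_isAlgebraic_algebraicClosure {b : ℂ}
    (hb : IsAlgebraic (algebraicClosure ℚ ℂ) b) : IsAlgebraic ℚ b := by
  have hbL : IsIntegral (algebraicClosure ℚ ℂ) b := hb.isIntegral
  haveI : Algebra.IsAlgebraic ℚ (algebraicClosure ℚ ℂ) := algebraicClosure.isAlgebraic ℚ ℂ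
  haveI : Algebra.IsIntegral ℚ (algebraicClosure ℚ ℂ) := Algebra.IsAlgebraic.isIntegral
  exact (isIntegral_trans (R := ℚ) b hbL).isAlgebraic

section Bivariate

variable {K : Type*} [Field K] (ι : K →+* ℂ)

/-- A bivariate polynomial over a subfield `K ↪ ℂ` vanishing at all complex points `(u, v)` with
`u ≠ 0` (outer variable `↦ u`, inner variable `↦ v`) is zero. [folklore] -/
theorem eq_zero_of_forall_eval₂_eval₂_eq_zero (P : K[X][X])
    (h : ∀ u v : ℂ, u ≠ 0 → eval₂ (eval₂RingHom ι v) u P = 0) : P = 0 := by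
  have hcoef : ∀ (v : ℂ) (i : ℕ), eval₂ ι v (P.coeff i) = 0 := by
    intro v i
    set Q : ℂ[X] := P.map (eval₂RingHom ι v) with hQ
    have hQeval : ∀ u, Q.eval u = eval₂ (eval₂RingHom ι v) u P := fun u => by
      rw [hQ, eval_map]
    have hQ0 : Q = 0 := by
      apply Polynomial.eq_zero_of_infinite_isRoot
      apply ((Set.finite_singleton (0 : ℂ)).infinite_compl).mono
      intro u hu
      rw [Set.mem_compl_iff, Set.mem_singleton_iff] at hu
      rw [Set.mem_setOf_eq, IsRoot.def, hQeval u]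
      exact h u v hu
    have := congrArg (fun q => q.coeff i) hQ0
    simpa [hQ, coeff_map] using this
  ext i n
  have hci : (P.coeff i).map ι = 0 := by
    apply Polynomial.eq_zero_of_infinite_isRoot
    refine Set.infinite_univ.mono fun v _ => ?_
    rw [Set.mem_setOf_eq, IsRoot.def, eval_map]
    exact hcoef v i
  have : P.coeff i = 0 := (Polynomial.map_eq_zero_iff ι.injective).mp hci
  simp [this]

/-- The substitution `Y ↦ c + t·Y` on `K[Y][t]` (the ring endomorphism
`eval₂RingHom (eval₂RingHom (C ∘ C) (C (C c) + t · C Y)) t`) satisfies `P̃(u, w) = P(u, c + u w)`.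
[folklore] -/
theorem eval₂_eval₂_substAffine (c : K) (u w : ℂ) (P : K[X][X]) :
    eval₂ (eval₂RingHom ι w) u
        (eval₂ (eval₂RingHom ((C : K[X] →+* K[X][X]).comp (C : K →+* K[X]))
          (C (C c) + X * C X)) X P) =
      eval₂ (eval₂RingHom ι (ι c + u * w)) u P := by
  change ((eval₂RingHom (eval₂RingHom ι w) u).comp
      (eval₂RingHom (eval₂RingHom ((C : K[X] →+* K[X][X]).comp (C : K →+* K[X]))
        (C (C c) + X * C X)) X)) P =
    (eval₂RingHom (eval₂RingHom ι (ι c + u * w)) u) P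
  congr 1
  refine Polynomial.ringHom_ext (fun q => ?_) ?_
  · have h1 : (eval₂RingHom (eval₂RingHom ((C : K[X] →+* K[X][X]).comp (C : K →+* K[X]))
          (C (C c) + X * C X)) X) (C q) =
        eval₂RingHom ((C : K[X] →+* K[X][X]).comp (C : K →+* K[X])) (C (C c) + X * C X) q := by
      simp
    have h2 : (eval₂RingHom (eval₂RingHom ι (ι c + u * w)) u) (C q) =
        eval₂RingHom ι (ι c + u * w) q := by
      simp
    rw [RingHom.comp_apply, h1, h2]
    change ((eval₂RingHom (eval₂RingHom ι w) u).comp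
        (eval₂RingHom ((C : K[X] →+* K[X][X]).comp (C : K →+* K[X])) (C (C c) + X * C X))) q =
      (eval₂RingHom ι (ι c + u * w)) q
    congr 1
    refine Polynomial.ringHom_ext (fun a => ?_) ?_
    · simp
    · simp only [RingHom.coe_comp, Function.comp_apply, coe_eval₂RingHom, eval₂_X, eval₂_add,
        eval₂_C, eval₂_mul]
  · simp

/-- Continuity of `t ↦ P(t, Φ t)` for `P ∈ K[Y][t]` and `Φ` continuous. [folklore] -/
theorem continuousAt_eval₂_eval₂ {Φ : ℂ → ℂ} {t₀ : ℂ} (hΦ : ContinuousAt Φ t₀) (P : K[X][X]) :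
    ContinuousAt (fun t => eval₂ (eval₂RingHom ι (Φ t)) t P) t₀ := by
  refine Polynomial.induction_on' P (fun p q hp hq => ?_) (fun i a => ?_)
  · simp only [eval₂_add]
    exact hp.add hq
  · simp only [eval₂_monomial, coe_eval₂RingHom]
    refine ContinuousAt.mul ?_ ((continuous_pow i).continuousAt)
    have : (fun t => eval₂ ι (Φ t) a) = (fun y => (a.map ι).eval y) ∘ Φ := by
      funext t
      simp [eval_map]
    rw [this]
    exact ContinuousAt.comp (a.map ι).continuous.continuousAt hΦ

/-- **Reduction step.** If `P ∈ K[Y][t]` is nonzero and `P(t, Φ t) = 0` for small `t ≠ 0` with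
`Φ` continuous at `0`, then `P = tᵃ P₁` with `P₁(0, ·) ≠ 0`, `P₁(t, Φ t) = 0` for small `t ≠ 0`
and `P₁(0, Φ 0) = 0`. [folklore] -/
theorem exists_reduced_bivariate_relation {Φ : ℂ → ℂ} (hΦ : ContinuousAt Φ 0) {P : K[X][X]}
    (hP : P ≠ 0) (h : ∀ᶠ t in 𝓝[≠] (0 : ℂ), eval₂ (eval₂RingHom ι (Φ t)) t P = 0) :
    ∃ P₁ : K[X][X], P₁.coeff 0 ≠ 0 ∧
      (∀ᶠ t in 𝓝[≠] (0 : ℂ), eval₂ (eval₂RingHom ι (Φ t)) t P₁ = 0) ∧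
      eval₂ ι (Φ 0) (P₁.coeff 0) = 0 := by
  obtain ⟨P₁, hPeq, hndvd⟩ := P.exists_eq_pow_rootMultiplicity_mul_and_not_dvd hP 0
  rw [map_zero, sub_zero] at hPeq hndvd
  rw [X_dvd_iff] at hndvd
  have h1 : ∀ᶠ t in 𝓝[≠] (0 : ℂ), eval₂ (eval₂RingHom ι (Φ t)) t P₁ = 0 := by
    filter_upwards [h, self_mem_nhdsWithin] with t ht ht0
    rw [hPeq, eval₂_mul, eval₂_X_pow] at ht
    exact (mul_eq_zero.mp ht).resolve_left (pow_ne_zero _ ht0)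
  refine ⟨P₁, hndvd, h1, ?_⟩
  have hlim : Tendsto (fun t => eval₂ (eval₂RingHom ι (Φ t)) t P₁) (𝓝[≠] 0)
      (𝓝 (eval₂ (eval₂RingHom ι (Φ 0)) 0 P₁)) :=
    (continuousAt_eval₂_eval₂ ι hΦ P₁).tendsto.mono_left nhdsWithin_le_nhds
  have hlim0 : Tendsto (fun t => eval₂ (eval₂RingHom ι (Φ t)) t P₁) (𝓝[≠] 0) (𝓝 0) :=
    tendsto_const_nhds.congr' (h1.mono fun t ht => ht.symm)
  have := tendsto_nhds_unique hlim hlim0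
  rwa [eval₂_at_zero, coe_eval₂RingHom] at this

end Bivariate

/-- **Induction on Taylor coefficients.** If `Φ` has the power series `p` at `0` and
`P(t, Φ t) = 0` for small `t ≠ 0` with `P ∈ L[Y][t]` nonzero, `L` the field of complex algebraic
numbers, then every coefficient of `p` is algebraic over `ℚ`. [folklore] -/
theorem isAlgebraic_coeff_of_bivariate_relation : ∀ (n : ℕ) {Φ : ℂ → ℂ}
    {p : FormalMultilinearSeries ℂ ℂ ℂ} {P : Polynomial (Polynomial (algebraicClosure ℚ ℂ))},
    HasFPowerSeriesAt Φ p 0 → P ≠ 0 →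
    (∀ᶠ t in 𝓝[≠] (0 : ℂ),
      eval₂ (eval₂RingHom (algebraMap (algebraicClosure ℚ ℂ) ℂ) (Φ t)) t P = 0) →
    IsAlgebraic ℚ (p.coeff n) := by
  intro n
  induction n with
  | zero =>
    intro Φ p P hp hP h
    obtain ⟨P₁, h0, -, hroot⟩ := exists_reduced_bivariate_relation _ hp.continuousAt hP h
    have hΦ0 : IsAlgebraic ℚ (Φ 0) :=
      isAlgebraic_rat_of_isAlgebraic_algebraicClosure ⟨P₁.coeff 0, h0, by rwa [aeval_def]⟩
    change IsAlgebraic ℚ (p 0 1)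
    rwa [hp.coeff_zero]
  | succ n ih =>
    intro Φ p P hp hP h
    set L := algebraicClosure ℚ ℂ with hL
    obtain ⟨P₁, h0, h1, hroot⟩ := exists_reduced_bivariate_relation _ hp.continuousAt hP h
    have hΦ0 : IsAlgebraic ℚ (Φ 0) :=
      isAlgebraic_rat_of_isAlgebraic_algebraicClosure ⟨P₁.coeff 0, h0, by rwa [aeval_def]⟩
    set c : L := ⟨Φ 0, mem_algebraicClosure_iff.mpr hΦ0⟩ with hc
    have hcval : algebraMap L ℂ c = Φ 0 := rfl
    set P₂ : L[X][X] := eval₂ (eval₂RingHom ((C : L[X] →+* L[X][X]).comp (C : L →+* L[X]))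
      (C (C c) + X * C X)) X P₁ with hP₂
    have hP₁0 : P₁ ≠ 0 := fun hz => h0 (by rw [hz, coeff_zero])
    have hP₂0 : P₂ ≠ 0 := by
      intro hz
      apply hP₁0
      apply eq_zero_of_forall_eval₂_eval₂_eq_zero (algebraMap L ℂ)
      intro u v hu
      have key := eval₂_eval₂_substAffine (algebraMap L ℂ) c u ((v - Φ 0) / u) P₁
      rw [← hP₂, hz, eval₂_zero, hcval, mul_div_cancel₀ _ hu, add_sub_cancel] at key
      exact key.symm
    have h2 : ∀ᶠ t in 𝓝[≠] (0 : ℂ), eval₂ (eval₂RingHom (algebraMap L ℂ) (dslope Φ 0 t)) t P₂ = 0 := by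
      filter_upwards [h1] with t ht
      rw [hP₂, eval₂_eval₂_substAffine, hcval]
      have hds : Φ 0 + t * dslope Φ 0 t = Φ t := by
        have := sub_smul_dslope Φ 0 t
        rw [sub_zero, smul_eq_mul] at this
        rw [this]; ring
      rw [hds]; exact ht
    have := ih hp.has_fpower_series_dslope_fslope hP₂0 h2
    rwa [FormalMultilinearSeries.coeff_fslope] at this

/-- **Bivariate form.** If `Φ` is analytic at `0` and `P(t, Φ t) = 0` for small `t ≠ 0` with
`P ∈ L[Y][t]` nonzero (`L` the complex algebraic numbers), then all derivatives `Φ⁽ⁿ⁾(0)` are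
algebraic over `ℚ`. [folklore] -/
theorem isAlgebraic_iteratedDeriv_of_bivariate_relation {Φ : ℂ → ℂ} (hΦ : AnalyticAt ℂ Φ 0)
    {P : Polynomial (Polynomial (algebraicClosure ℚ ℂ))} (hP : P ≠ 0)
    (h : ∀ᶠ t in 𝓝[≠] (0 : ℂ),
      eval₂ (eval₂RingHom (algebraMap (algebraicClosure ℚ ℂ) ℂ) (Φ t)) t P = 0) (n : ℕ) :
    IsAlgebraic ℚ (iteratedDeriv n Φ 0) := by
  obtain ⟨p, r, hp⟩ := hΦ
  have hcoeff : (n.factorial : ℂ) * p.coeff n = iteratedDeriv n Φ 0 := by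
    have h := hp.factorial_smul (1 : ℂ) n
    rw [iteratedDeriv_eq_iteratedFDeriv, ← h, nsmul_eq_mul]
    rfl
  rw [← hcoeff]
  have halg := isAlgebraic_coeff_of_bivariate_relation n ⟨r, hp⟩ hP h
  rw [← mem_algebraicClosure_iff] at halg ⊢
  exact mul_mem (natCast_mem _ _) halg

/-- A polynomial in `ℂ[X, Y]` vanishing at all `(a, b)` with `a ≠ 0` and `b ≠ 0` is zero.
[folklore] -/
theorem mvPolynomial_fin_two_eq_zero_of_forall_eval_eq_zero (R : MvPolynomial (Fin 2) ℂ)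
    (h : ∀ a b : ℂ, a ≠ 0 → b ≠ 0 → MvPolynomial.eval ![a, b] R = 0) : R = 0 := by
  apply MvPolynomial.funext_set (fun _ => ({0}ᶜ : Set ℂ))
    (fun _ => (Set.finite_singleton (0 : ℂ)).infinite_compl)
  intro x hx
  have hx' : ∀ i, x i ≠ 0 := fun i => hx i (Set.mem_univ i)
  have hxv : x = ![x 0, x 1] := by
    funext i
    fin_cases i <;> rfl
  rw [map_zero, hxv]
  exact h _ _ (hx' 0) (hx' 1)

/-- **Clearing denominators.** If `R ∈ ℂ[X, Y]` is nonzero with algebraic coefficients, `e ≥ 1`,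
and `R(t⁻ᵉ, Φ(t)/tᴺ) = 0` for small `t ≠ 0`, then `P(t, Y) := t^{eD₀+ND₁} R(t⁻ᵉ, Y t⁻ᴺ)`
(`D₀, D₁` the partial degrees) is a nonzero element of `L[Y][t]` (`L` the complex algebraic
numbers) with `P(t, Φ t) = 0` for small `t ≠ 0`. [folklore] -/
theorem exists_bivariate_relation_of_mvPolynomial_relation {Φ : ℂ → ℂ} {e N : ℕ} (he : 0 < e)
    {R : MvPolynomial (Fin 2) ℂ} (hR : R ≠ 0) (halg : ∀ m, IsAlgebraic ℚ (R.coeff m))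
    (h : ∀ᶠ t in 𝓝[≠] (0 : ℂ), MvPolynomial.eval ![(t ^ e)⁻¹, Φ t / t ^ N] R = 0) :
    ∃ P : Polynomial (Polynomial (algebraicClosure ℚ ℂ)), P ≠ 0 ∧
      ∀ᶠ t in 𝓝[≠] (0 : ℂ),
        eval₂ (eval₂RingHom (algebraMap (algebraicClosure ℚ ℂ) ℂ) (Φ t)) t P = 0 := by
  classical
  set L := algebraicClosure ℚ ℂ with hL
  set D₀ : ℕ := R.degreeOf 0 with hD₀
  set D₁ : ℕ := R.degreeOf 1 with hD₁
  set cL : (Fin 2 →₀ ℕ) → L := fun m => ⟨R.coeff m, mem_algebraicClosure_iff.mpr (halg m)⟩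
    with hcL
  set P : L[X][X] := ∑ m ∈ R.support,
    C (C (cL m) * X ^ (m 1)) * X ^ (e * (D₀ - m 0) + N * (D₁ - m 1)) with hPdef
  -- the evaluation identity `P(u, v) = u^{eD₀+ND₁} R(u⁻ᵉ, v u⁻ᴺ)` for `u ≠ 0`
  have hev : ∀ u v : ℂ, u ≠ 0 → eval₂ (eval₂RingHom (algebraMap L ℂ) v) u P =
      u ^ (e * D₀ + N * D₁) * MvPolynomial.eval ![(u ^ e)⁻¹, v / u ^ N] R := by
    intro u v hu
    have hue : u ^ e ≠ 0 := pow_ne_zero _ hu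
    have huN : u ^ N ≠ 0 := pow_ne_zero _ hu
    rw [hPdef, eval₂_finsetSum, MvPolynomial.eval_eq', Finset.mul_sum]
    refine Finset.sum_congr rfl fun m hm => ?_
    have h0 : m 0 ≤ D₀ := MvPolynomial.monomial_le_degreeOf 0 hm
    have h1 : m 1 ≤ D₁ := MvPolynomial.monomial_le_degreeOf 1 hm
    have hι : (algebraMap L ℂ) (cL m) = R.coeff m := rfl
    simp only [eval₂_mul, eval₂_C, eval₂_X_pow, coe_eval₂RingHom, Fin.prod_univ_two,
      Matrix.cons_val_zero, Matrix.cons_val_one, hι]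
    have hD : e * D₀ + N * D₁ = e * (D₀ - m 0) + N * (D₁ - m 1) + e * m 0 + N * m 1 := by
      have h0' : D₀ - m 0 + m 0 = D₀ := Nat.sub_add_cancel h0
      have h1' : D₁ - m 1 + m 1 = D₁ := Nat.sub_add_cancel h1
      calc e * D₀ + N * D₁ = e * (D₀ - m 0 + m 0) + N * (D₁ - m 1 + m 1) := by rw [h0', h1']
        _ = _ := by ring
    rw [hD]
    simp only [pow_add, pow_mul, inv_pow, div_pow]
    field_simp
  have hrel : ∀ᶠ t in 𝓝[≠] (0 : ℂ), eval₂ (eval₂RingHom (algebraMap L ℂ) (Φ t)) t P = 0 := by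
    filter_upwards [h, self_mem_nhdsWithin] with t ht ht0
    rw [hev t (Φ t) ht0, ht, mul_zero]
  refine ⟨P, fun hP0 => hR ?_, hrel⟩
  -- `P ≠ 0`: otherwise `R` vanishes at every `(a, b)` with `a ≠ 0`
  apply mvPolynomial_fin_two_eq_zero_of_forall_eval_eq_zero
  intro a b ha _
  obtain ⟨u, hu⟩ := IsAlgClosed.exists_pow_nat_eq a⁻¹ he
  have hu0 : u ≠ 0 := by
    rintro rfl
    rw [zero_pow he.ne'] at hu
    exact inv_ne_zero ha hu.symm
  have key := hev u (b * u ^ N) hu0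
  rw [hP0, eval₂_zero, hu, inv_inv, mul_div_assoc, div_self (pow_ne_zero _ hu0), mul_one] at key
  exact (mul_eq_zero.mp key.symm).resolve_left (pow_ne_zero _ hu0)

/-- **Taylor coefficients of an analytic solution of an algebraic relation are algebraic.** Let
`Φ` be analytic at `0`, `e ≥ 1`, `N ≥ 0`, and let `R ∈ ℂ[X, Y]` be nonzero with algebraic
coefficients and `R(t⁻ᵉ, Φ(t)/tᴺ) = 0` on a punctured neighbourhood of `0`. Then every
`Φ⁽ⁿ⁾(0)` is algebraic over `ℚ`. [folklore] -/
theorem isAlgebraic_iteratedDeriv_of_mvPolynomial_relation (Φ : ℂ → ℂ) (e N : ℕ)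
    (R : MvPolynomial (Fin 2) ℂ) (he : 0 < e) (hΦ : AnalyticAt ℂ Φ 0) (hR : R ≠ 0)
    (halg : ∀ m, IsAlgebraic ℚ (R.coeff m))
    (h : ∀ᶠ t in 𝓝[≠] (0 : ℂ), MvPolynomial.eval ![(t ^ e)⁻¹, Φ t / t ^ N] R = 0) (n : ℕ) :
    IsAlgebraic ℚ (iteratedDeriv n Φ 0) := by
  obtain ⟨P, hP, hrel⟩ := exists_bivariate_relation_of_mvPolynomial_relation he hR halg h
  exact isAlgebraic_iteratedDeriv_of_bivariate_relation hΦ hP hrel n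

end Literature.NumberTheory.Transcendental

end
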